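import Mathlib
import HarnessLib
import Literature.RepresentationTheory.CompactGroups.WeylIntegralFormula
import Summits.Ventures.LatticeQCDFlow.Exactness.SpectralKernelJacobianWeylFact
import Summits.Ventures.LatticeQCDFlow.Exactness.SpectralCouplingLayerExactnessWeylFact
import Summits.Ventures.LatticeQCDFlow.Exactness.SU2SpectralCouplingLayerUnconditional
import Summits.Ventures.LatticeQCDFlow.Exactness.SU3TorusAlcoveJacobian

/-!
# The `SU(3)` spectral kernel and spectral coupling layer are exact transports of Haar — UNCONDITIONALLY; and for every `n` Weyl's formula is no longer a hypothesis

HONEST FRAMING: exact (Metropolis-corrected) sampling algorithms for lattice gauge theory;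
figures of merit are autocorrelation/cost numbers at stated couplings and volumes; no
continuum-physics claim.

Venture `LatticeQCDFlow` (cell pub-lqcd), topic `Exactness`; FANOUT row 10 (`eng-equiv`, engine
`latflow.equiv` `SUNSpectralCoupling` / `flows_jax.sun_flow` `preset_boyda2021` `SU(3)`: kernel
`u ↦ h(uS)(uS)⁻¹u` with `h` the conjugation-equivariant spectral map whose eigenvalue map is given on
the Weyl alcove by a cell flow and extended by `canonicalise` / `uncanonicalise`; Boyda et al.,
PRD 103 (2021) 074504 §III–IV, App. B).  NEW WORK of the cell assembling this row's
`SU3TorusAlcoveJacobian.lean` (`hfJ` for `N = 3`), `SpectralKernelJacobianWeylFact.lean` /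
`SpectralCouplingLayerExactnessWeylFact.lean` (exactness given Weyl's formula and `hfJ`) with the
tree's THEOREM `Literature.RepresentationTheory.CompactGroups.weylIntegralFormula_specialUnitary_holds`
(Weyl's integral formula for `SU(n)`, Bröcker–tom Dieck IV (1.11), PROVED in the tree by unit
lit-balaban-p28, 2026-08-23).  Nothing new is cited; no number; no definition.

## What is typed

* Every `n` (Weyl's formula discharged): **`hasJacobian_spectralKernel_specialUnitaryGroup_of_torusJacobian`**,
  **`hasJacobian_spectralCouplingLayer_specialUnitary_of_torusJacobian`**, and the `U(n)` twins
  `…_unitaryGroup_of_torusJacobian`, `…_unitary_of_torusJacobian` — the `SU(n)` / `U(n)` spectral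
  kernel and coupling layer are exact transports of (product) Haar GIVEN ONLY the torus Jacobian
  `hfJ` of the eigenvalue map and Boyda's identity for the booked density;
* `torusMap_permDiag` (any `n`: a permutation-equivariant eigenvalue map gives a Weyl-equivariant
  torus map), `torusMap_angleChart_su3` (the torus map on the `SU(3)` angle chart);
* **`hasJacobian_spectralKernel_su3_of_alcoveMap`** — the `SU(3)` spectral kernel whose eigenvalue
  map is permutation-equivariant and given on the alcove `A = {θ₀ < θ₁ < −θ₀−θ₁ < θ₀ + 2π}` by a
  flow `G` with `HasJacobian (Leb|_A) G JA` has `HasJacobian (Haar SU(3)) h J` — NO hypothesis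
  beyond the architecture;
* **`hasJacobian_spectralCouplingLayer_su3_of_alcoveMaps`** — the `SU(3)` spectral coupling layer
  `Theory2.coupleFun p (u ↦ h a y (uS)(uS)⁻¹u)` is an exact transport of `⊗ Haar_{SU(3)}` with
  `coupleJac` of the booked densities — UNCONDITIONAL.

NOT here: `N ≥ 4` (general stick-breaking chart and `S_N` chambers); the residual layer's
Jacobian; any number.
-/

noncomputable section

namespace Summit.Ventures.LatticeQCDFlow.Exactness

open MeasureTheory Matrix Set Real
open Literature.LinearAlgebra.Matrix
open Literature.MathematicalPhysics.QuantumFieldTheory (haarProbability)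
open Literature.RepresentationTheory.CompactGroups
open scoped ENNReal

/-! ## Every `n`: Weyl's integral formula is a theorem of the tree -/

section EveryN

variable {n : Type} [Fintype n] [DecidableEq n]

/-- **`SU(n)` spectral kernel: `HasJacobian (Haar SU(n)) h J` given ONLY the torus Jacobian `J_f`
of the eigenvalue map and Boyda's identity for `J`** (Weyl's integral formula is the tree's theorem
`weylIntegralFormula_specialUnitary_holds`). -/
theorem hasJacobian_spectralKernel_specialUnitaryGroup_of_torusJacobian
    {f : (n → ℂ) → (n → ℂ)} (hfc : ContinuousOn f {d | ∀ i, ‖d i‖ = 1})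
    {h : Matrix.specialUnitaryGroup n ℂ → Matrix.specialUnitaryGroup n ℂ}
    (hagree : ∀ (P : Matrix.specialUnitaryGroup n ℂ) (V : Matrix n n ℂ) (d : n → ℂ),
      V ∈ Matrix.unitaryGroup n ℂ → (P : Matrix n n ℂ) = V * diagonal d * star V →
        ((h P : Matrix.specialUnitaryGroup n ℂ) : Matrix n n ℂ) = V * diagonal (f d) * star V)
    {fT : specialDiagonalTorus n → specialDiagonalTorus n}
    (hfT : ∀ t : specialDiagonalTorus n, ((fT t : Matrix.specialUnitaryGroup n ℂ) : Matrix n n ℂ) =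
      diagonal (f fun i => ((t : Matrix.specialUnitaryGroup n ℂ) : Matrix n n ℂ) i i))
    {Jf : specialDiagonalTorus n → ℝ≥0∞} (hfJ : HasJacobian (haarProbability (specialDiagonalTorus n)) fT Jf)
    {J : Matrix.specialUnitaryGroup n ℂ → ℝ≥0∞} (hJm : Measurable J)
    (hJ : ∀ (g : Matrix.specialUnitaryGroup n ℂ) (t : specialDiagonalTorus n),
      J (g * (t : Matrix.specialUnitaryGroup n ℂ) * g⁻¹) * ENNReal.ofReal
          ((∏ i, ∏ j ∈ Finset.univ.erase i,
            ‖((t : Matrix.specialUnitaryGroup n ℂ) : Matrix n n ℂ) i i -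
              ((t : Matrix.specialUnitaryGroup n ℂ) : Matrix n n ℂ) j j‖) / (Fintype.card n).factorial) =
        Jf t * ENNReal.ofReal
          ((∏ i, ∏ j ∈ Finset.univ.erase i,
            ‖((fT t : Matrix.specialUnitaryGroup n ℂ) : Matrix n n ℂ) i i -
              ((fT t : Matrix.specialUnitaryGroup n ℂ) : Matrix n n ℂ) j j‖) / (Fintype.card n).factorial)) :
    HasJacobian (haarProbability (Matrix.specialUnitaryGroup n ℂ)) h J :=
  hasJacobian_spectralKernel_specialUnitaryGroup_of_weylFact (weylIntegralFormula_specialUnitary_holds n)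
    hfc hagree hfT hfJ hJm hJ

/-- **`U(n)` spectral kernel: `HasJacobian (Haar U(n)) h J` given ONLY the torus Jacobian and Boyda's
identity** (Weyl's formula for `U(n)` is the tree's theorem `weylIntegralFormula_unitary_holds`). -/
theorem hasJacobian_spectralKernel_unitaryGroup_of_torusJacobian
    {f : (n → ℂ) → (n → ℂ)} (hfc : ContinuousOn f {d | ∀ i, ‖d i‖ = 1})
    {h : Matrix.unitaryGroup n ℂ → Matrix.unitaryGroup n ℂ}
    (hagree : ∀ (P : Matrix.unitaryGroup n ℂ) (V : Matrix n n ℂ) (d : n → ℂ),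
      V ∈ Matrix.unitaryGroup n ℂ → (P : Matrix n n ℂ) = V * diagonal d * star V →
        ((h P : Matrix.unitaryGroup n ℂ) : Matrix n n ℂ) = V * diagonal (f d) * star V)
    {fT : diagonalTorus n → diagonalTorus n}
    (hfT : ∀ t : diagonalTorus n, ((fT t : Matrix.unitaryGroup n ℂ) : Matrix n n ℂ) =
      diagonal (f fun i => ((t : Matrix.unitaryGroup n ℂ) : Matrix n n ℂ) i i))
    {Jf : diagonalTorus n → ℝ≥0∞} (hfJ : HasJacobian (haarProbability (diagonalTorus n)) fT Jf)
    {J : Matrix.unitaryGroup n ℂ → ℝ≥0∞} (hJm : Measurable J)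
    (hJ : ∀ (g : Matrix.unitaryGroup n ℂ) (t : diagonalTorus n),
      J (g * (t : Matrix.unitaryGroup n ℂ) * g⁻¹) * ENNReal.ofReal
          ((∏ i, ∏ j ∈ Finset.univ.erase i,
            ‖((t : Matrix.unitaryGroup n ℂ) : Matrix n n ℂ) i i -
              ((t : Matrix.unitaryGroup n ℂ) : Matrix n n ℂ) j j‖) / (Fintype.card n).factorial) =
        Jf t * ENNReal.ofReal
          ((∏ i, ∏ j ∈ Finset.univ.erase i,
            ‖((fT t : Matrix.unitaryGroup n ℂ) : Matrix n n ℂ) i i -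
              ((fT t : Matrix.unitaryGroup n ℂ) : Matrix n n ℂ) j j‖) / (Fintype.card n).factorial)) :
    HasJacobian (haarProbability (Matrix.unitaryGroup n ℂ)) h J :=
  hasJacobian_spectralKernel_unitaryGroup_of_weylFact (weylIntegralFormula_unitary_holds n) hfc hagree hfT hfJ
    hJm hJ

/-- **`SU(n)` spectral coupling layer: exact transport of `⊗ Haar_{SU(n)}` with the booked density,
given ONLY the per-link torus Jacobians** (Weyl's formula discharged by the tree's theorem). -/
theorem hasJacobian_spectralCouplingLayer_specialUnitary_of_torusJacobian {ι : Type*} [Fintype ι]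
    (p : ι → Prop) [DecidablePred p]
    (S : {i // p i} → ({i // ¬p i} → Matrix.specialUnitaryGroup n ℂ) → Matrix.specialUnitaryGroup n ℂ)
    (hS : ∀ a, Continuous (S a))
    (f : {i // p i} → ({i // ¬p i} → Matrix.specialUnitaryGroup n ℂ) → (n → ℂ) → (n → ℂ))
    (hf : ∀ a, ContinuousOn
      (fun q : ({i // ¬p i} → Matrix.specialUnitaryGroup n ℂ) × (n → ℂ) => f a q.1 q.2)
      {q | ∀ i, ‖q.2 i‖ = 1})
    (h : {i // p i} → ({i // ¬p i} → Matrix.specialUnitaryGroup n ℂ) →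
      Matrix.specialUnitaryGroup n ℂ → Matrix.specialUnitaryGroup n ℂ)
    (hagree : ∀ a y (P : Matrix.specialUnitaryGroup n ℂ) (V : Matrix n n ℂ) (d : n → ℂ),
      V ∈ Matrix.unitaryGroup n ℂ → (P : Matrix n n ℂ) = V * diagonal d * star V →
        ((h a y P : Matrix.specialUnitaryGroup n ℂ) : Matrix n n ℂ) = V * diagonal (f a y d) * star V)
    (fT : {i // p i} → ({i // ¬p i} → Matrix.specialUnitaryGroup n ℂ) →
      specialDiagonalTorus n → specialDiagonalTorus n)
    (hfT : ∀ a y (t : specialDiagonalTorus n),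
      ((fT a y t : Matrix.specialUnitaryGroup n ℂ) : Matrix n n ℂ) =
        diagonal (f a y fun i => ((t : Matrix.specialUnitaryGroup n ℂ) : Matrix n n ℂ) i i))
    (JfT : {i // p i} → ({i // ¬p i} → Matrix.specialUnitaryGroup n ℂ) → specialDiagonalTorus n → ℝ≥0∞)
    (hfJ : ∀ a y, HasJacobian (haarProbability (specialDiagonalTorus n)) (fT a y) (JfT a y))
    (j : {i // p i} → ({i // ¬p i} → Matrix.specialUnitaryGroup n ℂ) → Matrix.specialUnitaryGroup n ℂ → ℝ)
    (hjc : ∀ a, Continuous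
      fun q : ({i // ¬p i} → Matrix.specialUnitaryGroup n ℂ) × Matrix.specialUnitaryGroup n ℂ =>
        j a q.1 q.2)
    (hj0 : ∀ a y g, 0 ≤ j a y g)
    (hJ : ∀ a y (g : Matrix.specialUnitaryGroup n ℂ) (t : specialDiagonalTorus n),
      ENNReal.ofReal (j a y (g * (t : Matrix.specialUnitaryGroup n ℂ) * g⁻¹)) * ENNReal.ofReal
          ((∏ i, ∏ k ∈ Finset.univ.erase i,
            ‖((t : Matrix.specialUnitaryGroup n ℂ) : Matrix n n ℂ) i i -
              ((t : Matrix.specialUnitaryGroup n ℂ) : Matrix n n ℂ) k k‖) / (Fintype.card n).factorial) =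
        JfT a y t * ENNReal.ofReal
          ((∏ i, ∏ k ∈ Finset.univ.erase i,
            ‖((fT a y t : Matrix.specialUnitaryGroup n ℂ) : Matrix n n ℂ) i i -
              ((fT a y t : Matrix.specialUnitaryGroup n ℂ) : Matrix n n ℂ) k k‖) / (Fintype.card n).factorial)) :
    HasJacobian (Measure.pi fun _ : ι => haarProbability (Matrix.specialUnitaryGroup n ℂ))
      (Theory2.coupleFun p fun a y u => h a y (u * S a y) * (u * S a y)⁻¹ * u)
      fun U => ENNReal.ofReal (Theory2.coupleJac p (fun a y u => j a y (u * S a y)) U) :=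
  hasJacobian_spectralCouplingLayer_specialUnitary_of_weylFact (weylIntegralFormula_specialUnitary_holds n) p S hS
    f hf h hagree fT hfT JfT hfJ j hjc hj0 hJ

/-- **`U(n)` spectral coupling layer: exact transport of `⊗ Haar_{U(n)}` with the booked density,
given ONLY the per-link torus Jacobians.** -/
theorem hasJacobian_spectralCouplingLayer_unitary_of_torusJacobian {ι : Type*} [Fintype ι]
    (p : ι → Prop) [DecidablePred p]
    (S : {i // p i} → ({i // ¬p i} → Matrix.unitaryGroup n ℂ) → Matrix.unitaryGroup n ℂ)
    (hS : ∀ a, Continuous (S a))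
    (f : {i // p i} → ({i // ¬p i} → Matrix.unitaryGroup n ℂ) → (n → ℂ) → (n → ℂ))
    (hf : ∀ a, ContinuousOn
      (fun q : ({i // ¬p i} → Matrix.unitaryGroup n ℂ) × (n → ℂ) => f a q.1 q.2)
      {q | ∀ i, ‖q.2 i‖ = 1})
    (h : {i // p i} → ({i // ¬p i} → Matrix.unitaryGroup n ℂ) →
      Matrix.unitaryGroup n ℂ → Matrix.unitaryGroup n ℂ)
    (hagree : ∀ a y (P : Matrix.unitaryGroup n ℂ) (V : Matrix n n ℂ) (d : n → ℂ),
      V ∈ Matrix.unitaryGroup n ℂ → (P : Matrix n n ℂ) = V * diagonal d * star V →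
        ((h a y P : Matrix.unitaryGroup n ℂ) : Matrix n n ℂ) = V * diagonal (f a y d) * star V)
    (fT : {i // p i} → ({i // ¬p i} → Matrix.unitaryGroup n ℂ) → diagonalTorus n → diagonalTorus n)
    (hfT : ∀ a y (t : diagonalTorus n),
      ((fT a y t : Matrix.unitaryGroup n ℂ) : Matrix n n ℂ) =
        diagonal (f a y fun i => ((t : Matrix.unitaryGroup n ℂ) : Matrix n n ℂ) i i))
    (JfT : {i // p i} → ({i // ¬p i} → Matrix.unitaryGroup n ℂ) → diagonalTorus n → ℝ≥0∞)
    (hfJ : ∀ a y, HasJacobian (haarProbability (diagonalTorus n)) (fT a y) (JfT a y))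
    (j : {i // p i} → ({i // ¬p i} → Matrix.unitaryGroup n ℂ) → Matrix.unitaryGroup n ℂ → ℝ)
    (hjc : ∀ a, Continuous
      fun q : ({i // ¬p i} → Matrix.unitaryGroup n ℂ) × Matrix.unitaryGroup n ℂ => j a q.1 q.2)
    (hj0 : ∀ a y g, 0 ≤ j a y g)
    (hJ : ∀ a y (g : Matrix.unitaryGroup n ℂ) (t : diagonalTorus n),
      ENNReal.ofReal (j a y (g * (t : Matrix.unitaryGroup n ℂ) * g⁻¹)) * ENNReal.ofReal
          ((∏ i, ∏ k ∈ Finset.univ.erase i,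
            ‖((t : Matrix.unitaryGroup n ℂ) : Matrix n n ℂ) i i -
              ((t : Matrix.unitaryGroup n ℂ) : Matrix n n ℂ) k k‖) / (Fintype.card n).factorial) =
        JfT a y t * ENNReal.ofReal
          ((∏ i, ∏ k ∈ Finset.univ.erase i,
            ‖((fT a y t : Matrix.unitaryGroup n ℂ) : Matrix n n ℂ) i i -
              ((fT a y t : Matrix.unitaryGroup n ℂ) : Matrix n n ℂ) k k‖) / (Fintype.card n).factorial)) :
    HasJacobian (Measure.pi fun _ : ι => haarProbability (Matrix.unitaryGroup n ℂ))
      (Theory2.coupleFun p fun a y u => h a y (u * S a y) * (u * S a y)⁻¹ * u)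
      fun U => ENNReal.ofReal (Theory2.coupleJac p (fun a y u => j a y (u * S a y)) U) :=
  hasJacobian_spectralCouplingLayer_unitary_of_weylFact (weylIntegralFormula_unitary_holds n) p S hS f hf h hagree
    fT hfT JfT hfJ j hjc hj0 hJ

end EveryN

/-! ## Weyl-equivariant torus maps from permutation-equivariant eigenvalue maps (any `n`) -/

section TorusMap

variable {n : Type*} [Fintype n] [DecidableEq n]

/-- **A permutation-equivariant eigenvalue map gives a Weyl-equivariant torus map**: if
`f (d ∘ σ) = (f d) ∘ σ` on the unimodular torus and `(P t)_ii = t_{σi σi}`, then `fT (P t) = P (fT t)`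
(`canonicalise` remembers the permutation, `uncanonicalise` applies it back). -/
theorem torusMap_permDiag {σ : Equiv.Perm n} {P : specialDiagonalTorus n → specialDiagonalTorus n}
    (hP : ∀ t i, (((P t : specialDiagonalTorus n) : Matrix.specialUnitaryGroup n ℂ) : Matrix n n ℂ) i i =
      ((t : Matrix.specialUnitaryGroup n ℂ) : Matrix n n ℂ) (σ i) (σ i))
    {f : (n → ℂ) → (n → ℂ)} (hfperm : ∀ d : n → ℂ, (∀ i, ‖d i‖ = 1) → f (fun i => d (σ i)) = fun i => f d (σ i))
    {fT : specialDiagonalTorus n → specialDiagonalTorus n}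
    (hfT : ∀ t : specialDiagonalTorus n, ((fT t : Matrix.specialUnitaryGroup n ℂ) : Matrix n n ℂ) =
      diagonal (f fun i => ((t : Matrix.specialUnitaryGroup n ℂ) : Matrix n n ℂ) i i))
    (t : specialDiagonalTorus n) : fT (P t) = P (fT t) := by
  refine specialDiagonalTorus_ext fun i => ?_
  have hentries : (fun i => (((P t : specialDiagonalTorus n) : Matrix.specialUnitaryGroup n ℂ) : Matrix n n ℂ) i i) =
      fun i => ((t : Matrix.specialUnitaryGroup n ℂ) : Matrix n n ℂ) (σ i) (σ i) :=
    funext (hP t)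
  rw [hfT, diagonal_apply_eq, hentries, hfperm _ (norm_specialDiagonalTorus_apply t), hP, hfT, diagonal_apply_eq]

end TorusMap

/-! ## `SU(3)`: unconditional exactness -/

section SU3

variable {E : (Fin 2 → ℝ) → specialDiagonalTorus (Fin 3)}
  (hE : ∀ θ (i : Fin 3), (((E θ : specialDiagonalTorus (Fin 3)) : Matrix.specialUnitaryGroup (Fin 3) ℂ) :
    Matrix (Fin 3) (Fin 3) ℂ) i i = (Circle.exp ((![θ 0, θ 1, -(θ 0 + θ 1)] : Fin 3 → ℝ) i) : ℂ))
  {P : Equiv.Perm (Fin 3) → specialDiagonalTorus (Fin 3) → specialDiagonalTorus (Fin 3)}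
  (hP : ∀ σ t i,
    (((P σ t : specialDiagonalTorus (Fin 3)) : Matrix.specialUnitaryGroup (Fin 3) ℂ) : Matrix (Fin 3) (Fin 3) ℂ) i i =
      ((t : Matrix.specialUnitaryGroup (Fin 3) ℂ) : Matrix (Fin 3) (Fin 3) ℂ) (σ i) (σ i))

include hE in
/-- **The torus map on the `SU(3)` angle chart**: if `f(e^{i x(θ)}) = e^{i x(G θ)}` then
`fT (E θ) = E (G θ)`. -/
theorem torusMap_angleChart_su3 {f : (Fin 3 → ℂ) → (Fin 3 → ℂ)}
    {fT : specialDiagonalTorus (Fin 3) → specialDiagonalTorus (Fin 3)}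
    (hfT : ∀ t : specialDiagonalTorus (Fin 3),
      ((fT t : Matrix.specialUnitaryGroup (Fin 3) ℂ) : Matrix (Fin 3) (Fin 3) ℂ) =
        diagonal (f fun i => ((t : Matrix.specialUnitaryGroup (Fin 3) ℂ) : Matrix (Fin 3) (Fin 3) ℂ) i i))
    {G : (Fin 2 → ℝ) → (Fin 2 → ℝ)} {θ : Fin 2 → ℝ}
    (hfθ : f (fun i => (Circle.exp ((![θ 0, θ 1, -(θ 0 + θ 1)] : Fin 3 → ℝ) i) : ℂ)) =
      fun i => (Circle.exp ((![(G θ) 0, (G θ) 1, -((G θ) 0 + (G θ) 1)] : Fin 3 → ℝ) i) : ℂ)) :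
    fT (E θ) = E (G θ) := by
  refine specialDiagonalTorus_ext fun i => ?_
  have hentries : (fun i => (((E θ : specialDiagonalTorus (Fin 3)) : Matrix.specialUnitaryGroup (Fin 3) ℂ) :
      Matrix (Fin 3) (Fin 3) ℂ) i i) = fun i => (Circle.exp ((![θ 0, θ 1, -(θ 0 + θ 1)] : Fin 3 → ℝ) i) : ℂ) :=
    funext (hE θ)
  rw [hfT, diagonal_apply_eq, hentries, hfθ, hE]

include hE hP

/-- **The `SU(3)` spectral kernel is an exact transport of Haar with the booked density —
UNCONDITIONALLY.**  Eigenvalue map `f` continuous on the unimodular torus, permutation-equivariant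
(`f (d ∘ σ) = (f d) ∘ σ`), and given on the Weyl alcove `A = {θ₀ < θ₁ < −θ₀−θ₁ < θ₀ + 2π}` (free
eigen-phases) by a flow `G` with `HasJacobian (Leb|_A) G JA` (e.g. the engine's box → simplex →
alcove flow, `hasJacobian_alcove_of_boxFlow_su3`): `f(e^{i x(θ)}) = e^{i x(Gθ)}`; kernel `h`
following the spectral recipe of `f`; torus map `fT`; torus density `Jf` (measurable, `= JA` on the
alcove through the chart `E`, invariant under the phase permutations `P σ`); booked density `J`
(measurable) with Boyda's identity.  Then `HasJacobian (Haar SU(3)) h J`.  Weyl's formula enters as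
the tree's THEOREM `weylIntegralFormula_specialUnitary_holds (Fin 3)`, the torus Jacobian as
`hasJacobian_su3Torus_of_alcoveMap`. -/
theorem hasJacobian_spectralKernel_su3_of_alcoveMap
    {f : (Fin 3 → ℂ) → (Fin 3 → ℂ)} (hfc : ContinuousOn f {d | ∀ i, ‖d i‖ = 1})
    (hfperm : ∀ (σ : Equiv.Perm (Fin 3)) (d : Fin 3 → ℂ), (∀ i, ‖d i‖ = 1) →
      f (fun i => d (σ i)) = fun i => f d (σ i))
    {G : (Fin 2 → ℝ) → (Fin 2 → ℝ)} {JA : (Fin 2 → ℝ) → ℝ≥0∞}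
    (hG : HasJacobian ((volume : Measure (Fin 2 → ℝ)).restrict
      {θ : Fin 2 → ℝ | θ 0 < θ 1 ∧ θ 1 < -(θ 0 + θ 1) ∧ -(θ 0 + θ 1) < θ 0 + 2 * π}) G JA)
    (hfG : ∀ θ : Fin 2 → ℝ, θ 0 < θ 1 → θ 1 < -(θ 0 + θ 1) → -(θ 0 + θ 1) < θ 0 + 2 * π →
      f (fun i => (Circle.exp ((![θ 0, θ 1, -(θ 0 + θ 1)] : Fin 3 → ℝ) i) : ℂ)) =
        fun i => (Circle.exp ((![(G θ) 0, (G θ) 1, -((G θ) 0 + (G θ) 1)] : Fin 3 → ℝ) i) : ℂ))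
    {h : Matrix.specialUnitaryGroup (Fin 3) ℂ → Matrix.specialUnitaryGroup (Fin 3) ℂ}
    (hagree : ∀ (Q : Matrix.specialUnitaryGroup (Fin 3) ℂ) (V : Matrix (Fin 3) (Fin 3) ℂ) (d : Fin 3 → ℂ),
      V ∈ Matrix.unitaryGroup (Fin 3) ℂ → (Q : Matrix (Fin 3) (Fin 3) ℂ) = V * diagonal d * star V →
        ((h Q : Matrix.specialUnitaryGroup (Fin 3) ℂ) : Matrix (Fin 3) (Fin 3) ℂ) = V * diagonal (f d) * star V)
    {fT : specialDiagonalTorus (Fin 3) → specialDiagonalTorus (Fin 3)}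
    (hfT : ∀ t : specialDiagonalTorus (Fin 3),
      ((fT t : Matrix.specialUnitaryGroup (Fin 3) ℂ) : Matrix (Fin 3) (Fin 3) ℂ) =
        diagonal (f fun i => ((t : Matrix.specialUnitaryGroup (Fin 3) ℂ) : Matrix (Fin 3) (Fin 3) ℂ) i i))
    {Jf : specialDiagonalTorus (Fin 3) → ℝ≥0∞} (hJfm : Measurable Jf)
    (hJA : ∀ θ : Fin 2 → ℝ, θ 0 < θ 1 → θ 1 < -(θ 0 + θ 1) → -(θ 0 + θ 1) < θ 0 + 2 * π →
      Jf (E θ) = JA θ)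
    (hJinv : ∀ σ t, Jf (P σ t) = Jf t)
    {J : Matrix.specialUnitaryGroup (Fin 3) ℂ → ℝ≥0∞} (hJm : Measurable J)
    (hJ : ∀ (g : Matrix.specialUnitaryGroup (Fin 3) ℂ) (t : specialDiagonalTorus (Fin 3)),
      J (g * (t : Matrix.specialUnitaryGroup (Fin 3) ℂ) * g⁻¹) * ENNReal.ofReal
          ((∏ i, ∏ k ∈ Finset.univ.erase i,
            ‖((t : Matrix.specialUnitaryGroup (Fin 3) ℂ) : Matrix (Fin 3) (Fin 3) ℂ) i i -
              ((t : Matrix.specialUnitaryGroup (Fin 3) ℂ) : Matrix (Fin 3) (Fin 3) ℂ) k k‖) /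
                (Fintype.card (Fin 3)).factorial) =
        Jf t * ENNReal.ofReal
          ((∏ i, ∏ k ∈ Finset.univ.erase i,
            ‖((fT t : Matrix.specialUnitaryGroup (Fin 3) ℂ) : Matrix (Fin 3) (Fin 3) ℂ) i i -
              ((fT t : Matrix.specialUnitaryGroup (Fin 3) ℂ) : Matrix (Fin 3) (Fin 3) ℂ) k k‖) /
                (Fintype.card (Fin 3)).factorial)) :
    HasJacobian (haarProbability (Matrix.specialUnitaryGroup (Fin 3) ℂ)) h J := by
  have hfTm : Measurable fT := measurable_torusMap_of_continuousOn hfc hfT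
  have hfJ : HasJacobian (haarProbability (specialDiagonalTorus (Fin 3))) fT Jf :=
    hasJacobian_su3Torus_of_alcoveMap hE hP hG hfTm hJfm
      (fun θ h0 h1 h2 => torusMap_angleChart_su3 hE hfT (hfG θ h0 h1 h2)) hJA
      (fun σ t => torusMap_permDiag (hP σ) (hfperm σ) hfT t) hJinv
  exact hasJacobian_spectralKernel_specialUnitaryGroup_of_weylFact (weylIntegralFormula_specialUnitary_holds (Fin 3))
    hfc hagree hfT hfJ hJm hJ

/-- **The `SU(3)` spectral coupling layer is an exact transport of product Haar with exactly the
booked density — UNCONDITIONALLY.**  Links `ι`, mask `p`; per active link `a` and frozen context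
`y`: a staple `S a y` (continuous in `y`), an eigenvalue map `f a y` (jointly continuous on
context × unimodular torus, permutation-equivariant) given on the alcove by a flow `G a y` with
`HasJacobian (Leb|_A) (G a y) (JA a y)`, a kernel `h a y` following its recipe, its torus map
`fT a y` and torus density `JfT a y` (measurable, `= JA a y` on the alcove through `E`, invariant
under the phase permutations), and a booked density `j a y ≥ 0` (jointly continuous) with Boyda's
identity.  Then the coupling layer `Theory2.coupleFun p (u ↦ h a y (u S)(u S)⁻¹ u)` has
`HasJacobian (⊗_ι Haar_{SU(3)}) _ (ofReal ∘ Theory2.coupleJac p (j at the loops))`. -/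
theorem hasJacobian_spectralCouplingLayer_su3_of_alcoveMaps {ι : Type*} [Fintype ι]
    (p : ι → Prop) [DecidablePred p]
    (S : {i // p i} → ({i // ¬p i} → Matrix.specialUnitaryGroup (Fin 3) ℂ) → Matrix.specialUnitaryGroup (Fin 3) ℂ)
    (hS : ∀ a, Continuous (S a))
    (f : {i // p i} → ({i // ¬p i} → Matrix.specialUnitaryGroup (Fin 3) ℂ) → (Fin 3 → ℂ) → (Fin 3 → ℂ))
    (hf : ∀ a, ContinuousOn
      (fun q : ({i // ¬p i} → Matrix.specialUnitaryGroup (Fin 3) ℂ) × (Fin 3 → ℂ) => f a q.1 q.2)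
      {q | ∀ i, ‖q.2 i‖ = 1})
    (hfperm : ∀ a y (σ : Equiv.Perm (Fin 3)) (d : Fin 3 → ℂ), (∀ i, ‖d i‖ = 1) →
      f a y (fun i => d (σ i)) = fun i => f a y d (σ i))
    (G : {i // p i} → ({i // ¬p i} → Matrix.specialUnitaryGroup (Fin 3) ℂ) → (Fin 2 → ℝ) → (Fin 2 → ℝ))
    (JA : {i // p i} → ({i // ¬p i} → Matrix.specialUnitaryGroup (Fin 3) ℂ) → (Fin 2 → ℝ) → ℝ≥0∞)
    (hG : ∀ a y, HasJacobian ((volume : Measure (Fin 2 → ℝ)).restrict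
      {θ : Fin 2 → ℝ | θ 0 < θ 1 ∧ θ 1 < -(θ 0 + θ 1) ∧ -(θ 0 + θ 1) < θ 0 + 2 * π}) (G a y) (JA a y))
    (hfG : ∀ a y (θ : Fin 2 → ℝ), θ 0 < θ 1 → θ 1 < -(θ 0 + θ 1) → -(θ 0 + θ 1) < θ 0 + 2 * π →
      f a y (fun i => (Circle.exp ((![θ 0, θ 1, -(θ 0 + θ 1)] : Fin 3 → ℝ) i) : ℂ)) =
        fun i => (Circle.exp ((![(G a y θ) 0, (G a y θ) 1, -((G a y θ) 0 + (G a y θ) 1)] : Fin 3 → ℝ) i) : ℂ))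
    (h : {i // p i} → ({i // ¬p i} → Matrix.specialUnitaryGroup (Fin 3) ℂ) →
      Matrix.specialUnitaryGroup (Fin 3) ℂ → Matrix.specialUnitaryGroup (Fin 3) ℂ)
    (hagree : ∀ a y (Q : Matrix.specialUnitaryGroup (Fin 3) ℂ) (V : Matrix (Fin 3) (Fin 3) ℂ) (d : Fin 3 → ℂ),
      V ∈ Matrix.unitaryGroup (Fin 3) ℂ → (Q : Matrix (Fin 3) (Fin 3) ℂ) = V * diagonal d * star V →
        ((h a y Q : Matrix.specialUnitaryGroup (Fin 3) ℂ) : Matrix (Fin 3) (Fin 3) ℂ) =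
          V * diagonal (f a y d) * star V)
    (fT : {i // p i} → ({i // ¬p i} → Matrix.specialUnitaryGroup (Fin 3) ℂ) →
      specialDiagonalTorus (Fin 3) → specialDiagonalTorus (Fin 3))
    (hfT : ∀ a y (t : specialDiagonalTorus (Fin 3)),
      ((fT a y t : Matrix.specialUnitaryGroup (Fin 3) ℂ) : Matrix (Fin 3) (Fin 3) ℂ) =
        diagonal (f a y fun i => ((t : Matrix.specialUnitaryGroup (Fin 3) ℂ) : Matrix (Fin 3) (Fin 3) ℂ) i i))
    (JfT : {i // p i} → ({i // ¬p i} → Matrix.specialUnitaryGroup (Fin 3) ℂ) →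
      specialDiagonalTorus (Fin 3) → ℝ≥0∞)
    (hJfTm : ∀ a y, Measurable (JfT a y))
    (hJA : ∀ a y (θ : Fin 2 → ℝ), θ 0 < θ 1 → θ 1 < -(θ 0 + θ 1) → -(θ 0 + θ 1) < θ 0 + 2 * π →
      JfT a y (E θ) = JA a y θ)
    (hJinv : ∀ a y σ t, JfT a y (P σ t) = JfT a y t)
    (j : {i // p i} → ({i // ¬p i} → Matrix.specialUnitaryGroup (Fin 3) ℂ) →
      Matrix.specialUnitaryGroup (Fin 3) ℂ → ℝ)
    (hjc : ∀ a, Continuous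
      fun q : ({i // ¬p i} → Matrix.specialUnitaryGroup (Fin 3) ℂ) × Matrix.specialUnitaryGroup (Fin 3) ℂ =>
        j a q.1 q.2)
    (hj0 : ∀ a y u, 0 ≤ j a y u)
    (hJ : ∀ a y (g : Matrix.specialUnitaryGroup (Fin 3) ℂ) (t : specialDiagonalTorus (Fin 3)),
      ENNReal.ofReal (j a y (g * (t : Matrix.specialUnitaryGroup (Fin 3) ℂ) * g⁻¹)) * ENNReal.ofReal
          ((∏ i, ∏ k ∈ Finset.univ.erase i,
            ‖((t : Matrix.specialUnitaryGroup (Fin 3) ℂ) : Matrix (Fin 3) (Fin 3) ℂ) i i -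
              ((t : Matrix.specialUnitaryGroup (Fin 3) ℂ) : Matrix (Fin 3) (Fin 3) ℂ) k k‖) /
                (Fintype.card (Fin 3)).factorial) =
        JfT a y t * ENNReal.ofReal
          ((∏ i, ∏ k ∈ Finset.univ.erase i,
            ‖((fT a y t : Matrix.specialUnitaryGroup (Fin 3) ℂ) : Matrix (Fin 3) (Fin 3) ℂ) i i -
              ((fT a y t : Matrix.specialUnitaryGroup (Fin 3) ℂ) : Matrix (Fin 3) (Fin 3) ℂ) k k‖) /
                (Fintype.card (Fin 3)).factorial)) :
    HasJacobian (Measure.pi fun _ : ι => haarProbability (Matrix.specialUnitaryGroup (Fin 3) ℂ))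
      (Theory2.coupleFun p fun a y u => h a y (u * S a y) * (u * S a y)⁻¹ * u)
      fun U => ENNReal.ofReal (Theory2.coupleJac p (fun a y u => j a y (u * S a y)) U) := by
  -- each fibre's eigenvalue map is continuous on the unimodular torus
  have hfc : ∀ a y, ContinuousOn (f a y) {d | ∀ i, ‖d i‖ = 1} := by
    intro a y
    have hslice : Continuous fun d : Fin 3 → ℂ => ((y, d) :
        ({i // ¬p i} → Matrix.specialUnitaryGroup (Fin 3) ℂ) × (Fin 3 → ℂ)) :=
      continuous_const.prodMk continuous_id
    exact (hf a).comp hslice.continuousOn fun d hd => hd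
  have hfJ : ∀ a y, HasJacobian (haarProbability (specialDiagonalTorus (Fin 3))) (fT a y) (JfT a y) := by
    intro a y
    exact hasJacobian_su3Torus_of_alcoveMap hE hP (hG a y) (measurable_torusMap_of_continuousOn (hfc a y) (hfT a y))
      (hJfTm a y) (fun θ h0 h1 h2 => torusMap_angleChart_su3 hE (hfT a y) (hfG a y θ h0 h1 h2)) (hJA a y)
      (fun σ t => torusMap_permDiag (hP σ) (hfperm a y σ) (hfT a y) t) (hJinv a y)
  exact hasJacobian_spectralCouplingLayer_specialUnitary_of_weylFact (weylIntegralFormula_specialUnitary_holds (Fin 3))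
    p S hS f hf h hagree fT hfT JfT hfJ j hjc hj0 hJ

end SU3

end Summit.Ventures.LatticeQCDFlow.Exactness
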